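import Literature.Computability.Complexity.BPPTruthTableClosure
import Literature.Computability.Complexity.BPExpOperator
import Literature.Computability.Complexity.CountingHierarchyProofs
import Literature.Computability.Complexity.ReductionsProofs
import Literature.Computability.Complexity.StringCopy

/-!
# Crux `ArithStatLadder.IqThreeNotPPoly` (stmt-QuantumAdvantage-2422): `BPP` is closed under one-sided randomized reductions

Uniform companion of `ArithStatLadderIqThreeNotPPolyRURClosure.lean` (line `Sketch`, gen-1 lead).
**If `f ∈ FP` maps every NO-instance `x ∉ L₁` OUTSIDE `L₂` for every seed (`f ⟨x, r⟩ ∉ L₂`), maps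
every YES-instance `x ∈ L₁` of length `n ≥ n₀` INTO `L₂` for at least a quarter of the seeds
`r ∈ {0,1}^{ℓ(n)}`, and `L₂ ∈ BPP`, then `L₁ ∈ BPP`** (`mem_BPP_of_rurReduction`; Arora–Barak 2009,
§7.6: "if `C ∈ BPP` and `B ≤ᵣ C` then `B ∈ BPP`", here for one-sided (RUR-type, Micciancio 2001 §2)
reductions with constant success, which are first amplified by `8` independent seeds).

Proof. With eight fresh seed blocks the language
`L_mid = {⟨x, w⟩ : |x| ≥ n₀ ∧ ∃ i < 8, f ⟨x, blockᵢ w⟩ ∈ L₂}` is a constant-query truth-table reduction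
to `L₂`, hence in `BPP` (`mem_BPP_of_ttList'`, the tree's `BPP^BPP = BPP` for fixed query lists);
for `x ∈ L₁` long, all eight blocks miss `L₂` with probability `≤ (3/4)^8` (EXACT product rule for
independent blocks, `bpprur_uniformProb_take_drop`, iterated: `bpprur_uniformProb_forall_blocks_le`),
and for `x ∉ L₁` no seed string is accepted (exactness). Running an error-`1/5` witness of `L_mid`
(`BPP_subset_bpErr`) on the remaining coins (re-pairing `⟨x, w r⟩ ↦ ⟨⟨x, w⟩, r⟩`, fresh coins
`uniformProb_block_le`, union bound) decides `L₁` on long inputs with error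
`≤ (3/4)^8 + 1/5 < 1/3`; short inputs are patched by `mem_BPP_of_eqOn_le`.
Theorems only; sorry-free. References: L. Adleman, FOCS 1978; S. Arora, B. Barak, *Computational
Complexity*, CUP 2009, §7.4.1, §7.5.2, §7.6; D. Micciancio, SIAM J. Comput. 30 (2001), §2.
-/

set_option linter.dupNamespace false -- D-0017: single-problem summit ⇒ `QuantumAdvantage.QuantumAdvantage` by design

noncomputable section

namespace Summit.QuantumAdvantage.QuantumAdvantage.Theorems.IqThreeNotPPoly

open scoped Classical
open _root_.Computability Polynomial Finset
open Literature.Computability.Complexity Literature.Computability.Complexity.Brick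

/-! ### Counting: independent coin blocks multiply -/

/-- **Product rule for a prefix block and the rest**: over `{0,1}^{ℓ+m}` the events "the first `ℓ`
coins lie in `B`" and "the remaining `m` coins lie in `E`" are independent, with probabilities
`Pr_ℓ[B]` and `Pr_m[E]`. [cite: AroraBarakCC2009, §A.2] -/
theorem bpprur_uniformProb_take_drop (ℓ m : ℕ) (B E : Set (List Bool)) :
    uniformProb (ℓ + m) {r | r.take ℓ ∈ B ∧ r.drop ℓ ∈ E} = uniformProb ℓ B * uniformProb m E := by
  set e : (Fin ℓ → Bool) × (Fin m → Bool) ≃ (Fin (ℓ + m) → Bool) := Fin.appendEquiv ℓ m with he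
  have hcard : (univ.filter fun g : Fin (ℓ + m) → Bool =>
        List.ofFn g ∈ {r : List Bool | r.take ℓ ∈ B ∧ r.drop ℓ ∈ E}).card =
      ((univ.filter fun u : Fin ℓ → Bool => List.ofFn u ∈ B) ×ˢ
        (univ.filter fun v : Fin m → Bool => List.ofFn v ∈ E)).card := by
    symm
    refine card_equiv e fun p => ?_
    obtain ⟨u, v⟩ := p
    have hsplit : List.ofFn (e (u, v)) = List.ofFn u ++ List.ofFn v := by
      simp [he, Fin.appendEquiv, List.ofFn_fin_append]
    have hu : (List.ofFn u).length = ℓ := List.length_ofFn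
    simp only [mem_product, mem_filter, mem_univ, true_and, Set.mem_setOf_eq, hsplit]
    rw [List.take_left' hu, List.drop_left' hu]
  have hcard' : ((univ.filter fun g : Fin (ℓ + m) → Bool =>
        List.ofFn g ∈ {r : List Bool | r.take ℓ ∈ B ∧ r.drop ℓ ∈ E}).card : ℝ) =
      ((univ.filter fun u : Fin ℓ → Bool => List.ofFn u ∈ B).card : ℝ) *
        ((univ.filter fun v : Fin m → Bool => List.ofFn v ∈ E).card : ℝ) := by
    exact_mod_cast hcard.trans (card_product _ _)
  have key : ((univ.filter fun g : Fin (ℓ + m) → Bool =>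
        List.ofFn g ∈ {r : List Bool | r.take ℓ ∈ B ∧ r.drop ℓ ∈ E}).card : ℝ) / 2 ^ (ℓ + m) =
      ((univ.filter fun u : Fin ℓ → Bool => List.ofFn u ∈ B).card : ℝ) / 2 ^ ℓ *
        (((univ.filter fun v : Fin m → Bool => List.ofFn v ∈ E).card : ℝ) / 2 ^ m) := by
    rw [hcard', pow_add]
    field_simp
  rw [uniformProb_eq_card_fun, uniformProb_eq_card_fun, uniformProb_eq_card_fun]
  convert key

/-- **All of `T` independent seed blocks are bad with probability `≤ δ^T`** (blocks of length `ℓ` at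
offsets `0, ℓ, …, (T−1)ℓ` of a coin string of length `Tℓ + d`; `Pr_ℓ[B] ≤ δ`).
[cite: AroraBarakCC2009, §7.4.1] -/
theorem bpprur_uniformProb_forall_blocks_le {ℓ : ℕ} (B : Set (List Bool)) {δ : ℝ} (hδ0 : 0 ≤ δ)
    (hδ : uniformProb ℓ B ≤ δ) :
    ∀ T d : ℕ, uniformProb (T * ℓ + d) {r | ∀ i < T, (r.drop (i * ℓ)).take ℓ ∈ B} ≤ δ ^ T := by
  intro T
  induction T with
  | zero =>
    intro d
    have hset : {r : List Bool | ∀ i < 0, (r.drop (i * ℓ)).take ℓ ∈ B} = Set.univ := by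
      ext r; simp
    rw [hset, uniformProb_univ, pow_zero]
  | succ T ih =>
    intro d
    have hset : {r : List Bool | ∀ i < T + 1, (r.drop (i * ℓ)).take ℓ ∈ B} =
        {r | r.take ℓ ∈ B ∧ r.drop ℓ ∈ {r' : List Bool | ∀ i < T, (r'.drop (i * ℓ)).take ℓ ∈ B}} := by
      ext r
      simp only [Set.mem_setOf_eq]
      constructor
      · intro h
        refine ⟨by simpa using h 0 (Nat.succ_pos T), fun i hi => ?_⟩
        have h' := h (i + 1) (by omega)
        rwa [show (i + 1) * ℓ = ℓ + i * ℓ by ring, ← List.drop_drop] at h'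
      · rintro ⟨h0, h⟩ i hi
        rcases i with _ | i
        · simpa using h0
        · have h' := h i (by omega)
          rwa [show (i + 1) * ℓ = ℓ + i * ℓ by ring, ← List.drop_drop]
    have hlen : (T + 1) * ℓ + d = ℓ + (T * ℓ + d) := by ring
    rw [hset, hlen, bpprur_uniformProb_take_drop]
    calc uniformProb ℓ B * uniformProb (T * ℓ + d) {r' : List Bool | ∀ i < T, (r'.drop (i * ℓ)).take ℓ ∈ B}
        ≤ δ * δ ^ T := mul_le_mul hδ (ih d) (uniformProb_nonneg _ _) hδ0
      _ = δ ^ (T + 1) := by ring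

/-- Error `≤ 1/3` against a `P` witness is membership in `BPP` (`uniformProb_compl`).
[cite: AroraBarakCC2009, §7.4.1] -/
theorem bpprur_mem_BPP_of_bpErr {L : Language Bool} {e : ℝ} (he : e ≤ 1 / 3)
    (h : L ∈ bpErr Classes.P e) : L ∈ BPP := by
  obtain ⟨L', hL', p, hp⟩ := h
  refine ⟨L', hL', p, fun x => ?_⟩
  have hx := hp x
  have hset : {y : List Bool | boolPair x y ∈ L' ↔ x ∈ L} =
      {y : List Bool | ¬ (boolPair x y ∈ L' ↔ x ∈ L)}ᶜ := by
    ext y; simp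
  rw [hset, uniformProb_compl]
  linarith

/-- A list of `n` Booleans read off a function is all-`false` iff every value is `false`. [folklore] -/
theorem bpprur_map_range_eq_replicate_iff (n : ℕ) (φ : ℕ → Bool) :
    (List.range n).map φ = List.replicate n false ↔ ∀ i < n, φ i = false := by
  rw [List.eq_replicate_iff]
  simp only [List.length_map, List.length_range, true_and, List.mem_map, List.mem_range,
    forall_exists_index, and_imp]
  constructor
  · intro h i hi
    exact h (φ i) i hi rfl
  · rintro h b i hi rfl
    exact h i hi

/-! ### The closure theorem -/

/-- **`BPP` is closed downwards under one-sided randomized polynomial-time many-one reductions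
with success probability `≥ 1/4` from some length on** (Adleman 1978 / Arora–Barak §7.6, uniform
form; RUR reductions in the sense of Micciancio 2001, §2). Data: `f ∈ FP` reading
`⟨x, r⟩ = boolPair x r`; seed length `ℓ(n)` (a polynomial); NO side exact for every seed; YES
side: `2^{ℓ(n)} ≤ 4 · #{r ∈ {0,1}^{ℓ(n)} : f ⟨x, r⟩ ∈ L₂}` for `x ∈ L₁`, `|x| = n ≥ n₀`.
[cite: AroraBarakCC2009, §7.6 (Def. 7.16)] -/
theorem mem_BPP_of_rurReduction :
    ∀ (L₁ L₂ : Language Bool) (f : List Bool → List Bool), f ∈ FP → ∀ (ℓ : Polynomial ℕ) (n₀ : ℕ), (∀ x : List Bool, x ∉ L₁ → ∀ r : List Bool, f (boolPair x r) ∉ L₂) → (∀ x : List Bool, x ∈ L₁ → n₀ ≤ x.length → 2 ^ (ℓ.eval x.length) ≤ 4 * (Finset.univ.filter (fun r : Fin (ℓ.eval x.length) → Bool => f (boolPair x (List.ofFn r)) ∈ L₂)).card) → L₂ ∈ BPP → L₁ ∈ BPP := by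
  intro L₁ L₂ f hf ℓ n₀ hNO hYES h₂
  -- the eight block query maps `gᵢ ⟨x, w⟩ = f ⟨x, blockᵢ w⟩`
  set g : ℕ → (List Bool → List Bool) := fun i =>
    f ∘ truncSndFn ℓ ∘ dropSndFn ((i : Polynomial ℕ) * ℓ) with hg
  have hg_apply : ∀ (i : ℕ) (x w : List Bool), g i (boolPair x w) =
      f (boolPair x ((w.drop (i * ℓ.eval x.length)).take (ℓ.eval x.length))) := by
    intro i x w
    simp only [hg, Function.comp_apply, dropSndFn_boolPair, truncSndFn_boolPair, eval_mul,
      eval_natCast, Nat.cast_id]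
  have hgFP : ∀ i, g i ∈ FP := fun i =>
    comp_mem_FP hf (comp_mem_FP (truncSndFn_mem_FP ℓ) (dropSndFn_mem_FP _))
  set Q : List (List Bool → List Bool) := (List.range 8).map g with hQdef
  have hQ : ∀ q ∈ Q, q ∈ FP := by
    intro q hq
    obtain ⟨i, -, rfl⟩ := List.mem_map.1 hq
    exact hgFP i
  -- the guarded OR language, a truth-table reduction to `L₂`
  set Lmid : Language Bool := {z | n₀ ≤ (fstF z).length ∧ ∃ i < 8, g i z ∈ L₂} with hLmid
  set AllFalse : Language Bool := {u | u = List.replicate 8 false} with hAllFalse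
  have hAF : AllFalse ∈ Classes.P := by
    have h := shortPart_mem_P AllFalse 9
    have e : ({u : List Bool | u ∈ AllFalse ∧ u.length < 9} : Language Bool) = AllFalse := by
      ext u
      simp only [hAllFalse, Set.mem_setOf_eq]
      constructor
      · exact fun h => h.1
      · rintro rfl; exact ⟨rfl, by simp⟩
    rwa [e] at h
  set F : Language Bool :=
    (fstF ⁻¹' (fstF ⁻¹' ({x : List Bool | n₀ ≤ x.length} : Language Bool) : Language Bool)) ⊓
      (sndF ⁻¹' AllFalseᶜ) with hF
  have hFP : F ∈ Classes.P :=
    inter_mem_P (preimage_mem_P (preimage_mem_P (setOf_le_length_mem_P n₀) fstF_mem_FP) fstF_mem_FP)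
      (preimage_mem_P (compl_mem_P_iff.2 hAF) sndF_mem_FP)
  have hLmidBPP : Lmid ∈ BPP := by
    refine mem_BPP_of_ttList' h₂ Q hQ hFP fun z => ?_
    change (n₀ ≤ (fstF z).length ∧ ∃ i < 8, g i z ∈ L₂) ↔
      (fstF (fstF (boolPair z (ttListBits L₂ Q z))) ∈ ({x : List Bool | n₀ ≤ x.length} : Set (List Bool)) ∧
        sndF (boolPair z (ttListBits L₂ Q z)) ∈ (AllFalseᶜ : Set (List Bool)))
    rw [fstF_boolPair, sndF_boolPair, Set.mem_compl_iff]
    simp only [Set.mem_setOf_eq, hAllFalse]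
    refine and_congr Iff.rfl ?_
    have hbits : ttListBits L₂ Q z = (List.range 8).map fun i => L₂.boolIndicator (g i z) := by
      simp only [ttListBits, hQdef, List.map_map]
      rfl
    rw [hbits, bpprur_map_range_eq_replicate_iff]
    constructor
    · rintro ⟨i, hi, hmem⟩ h
      have h' := h i hi
      rw [(Set.mem_iff_boolIndicator _ _).1 hmem] at h'
      exact Bool.noConfusion h'
    · intro h
      by_contra hne
      push Not at hne
      exact h fun i hi => (Set.notMem_iff_boolIndicator _ _).1 (hne i hi)
  -- it suffices to decide the long part of `L₁`
  set L₁' : Language Bool := {x | x ∈ L₁ ∧ n₀ ≤ x.length} with hL₁'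
  suffices hlong : L₁' ∈ BPP from
    mem_BPP_of_eqOn_le hlong n₀ fun x hx => ⟨fun h => ⟨h, hx⟩, fun h => h.1⟩
  -- an error-`1/5` witness of `Lmid`, run on fresh coins after the eight seed blocks
  obtain ⟨K', hK', p'', herr⟩ := BPP_subset_bpErr (by norm_num : (0 : ℝ) < 1 / 5) hLmidBPP
  set A : Polynomial ℕ := 8 * ℓ with hA
  set gre : List Bool → List Bool := fanoutFn (truncSndFn A) (sndF ∘ dropSndFn A) with hgre
  have hgreFP : gre ∈ FP :=
    fanoutFn_mem_FP (truncSndFn_mem_FP A) (comp_mem_FP sndF_mem_FP (dropSndFn_mem_FP A))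
  have hgre_apply : ∀ x r : List Bool, gre (boolPair x r) =
      boolPair (boolPair x (r.take (A.eval x.length))) (r.drop (A.eval x.length)) := by
    intro x r
    simp only [hgre, fanoutFn_apply, truncSndFn_boolPair, Function.comp_apply, dropSndFn_boolPair,
      sndF_boolPair]
  refine bpprur_mem_BPP_of_bpErr (e := (3 / 4 : ℝ) ^ 8 + 1 / 5) (by norm_num)
    ⟨gre ⁻¹' K', preimage_mem_P hK' hgreFP, A + p''.comp (2 * X + 2 + A), fun x => ?_⟩
  set l := ℓ.eval x.length with hl
  set a := A.eval x.length with ha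
  have hal : a = 8 * l := by simp only [ha, hA, eval_mul, eval_ofNat, hl]
  set b := p''.eval (2 * x.length + 2 + a) with hb
  have hlen : (A + p''.comp (2 * X + 2 + A)).eval x.length = a + b := by
    simp only [eval_add, eval_comp, eval_mul, eval_ofNat, eval_X, ha, hb]
  -- the two bad events
  set Out : Set (List Bool) := {r | ¬ (boolPair x (r.take a) ∈ Lmid ↔ x ∈ L₁')} with hOut
  set In : Set (List Bool) := {r | (r.drop a).take b ∈
    (fun w : List Bool => {r₂ : List Bool | ¬ (boolPair (boolPair x w) r₂ ∈ K' ↔ boolPair x w ∈ Lmid)})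
      (r.take a)} with hIn
  have hInP : uniformProb (a + b) In ≤ 1 / 5 := by
    have h := uniformProb_block_le (a := a) (ℓ := b) (d := 0)
      (fun w : List Bool => {r₂ : List Bool | ¬ (boolPair (boolPair x w) r₂ ∈ K' ↔ boolPair x w ∈ Lmid)})
      (δ := (1 / 5 : ℝ)) fun w hw => by
        have h2 := herr (boolPair x w)
        have hn : (boolPair x w).length = 2 * x.length + 2 + a := by rw [length_boolPair, hw]
        rwa [hn] at h2
    rw [Nat.add_zero] at h
    exact h
  have hOutP : uniformProb (a + b) Out ≤ (3 / 4 : ℝ) ^ 8 := by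
    by_cases hx : x ∈ L₁'
    · -- all eight blocks miss `L₂`
      set Bad : Set (List Bool) := {s | f (boolPair x s) ∉ L₂} with hBad
      have hBadP : uniformProb l Bad ≤ 3 / 4 := by
        have hY := hYES x hx.1 hx.2
        rw [← hl] at hY
        have hsplit := Finset.card_filter_add_card_filter_not
          (s := (univ : Finset (Fin l → Bool)))
          (fun r : Fin l → Bool => f (boolPair x (List.ofFn r)) ∈ L₂)
        rw [card_univ, card_fun_fin_bool] at hsplit
        have key : ((univ.filter fun r : Fin l → Bool =>
            ¬ f (boolPair x (List.ofFn r)) ∈ L₂).card : ℝ) / 2 ^ l ≤ 3 / 4 := by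
          rw [div_le_iff₀ (by positivity)]
          have hY' : (2 : ℝ) ^ l ≤ 4 * ((univ.filter fun r : Fin l → Bool =>
              f (boolPair x (List.ofFn r)) ∈ L₂).card : ℝ) := by exact_mod_cast hY
          have hs' : ((univ.filter fun r : Fin l → Bool => f (boolPair x (List.ofFn r)) ∈ L₂).card : ℝ) +
              ((univ.filter fun r : Fin l → Bool => ¬ f (boolPair x (List.ofFn r)) ∈ L₂).card : ℝ) =
                2 ^ l := by exact_mod_cast hsplit
          linarith
        rw [uniformProb_eq_card_fun]
        convert key using 5
        simp only [hBad, Set.mem_setOf_eq]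
      have hsub : ∀ r ∈ Out, r.length = a + b → r ∈ {r : List Bool | ∀ i < 8, (r.drop (i * l)).take l ∈ Bad} := by
        intro r hr _
        have hxL : x ∈ L₁' := hx
        simp only [hOut, Set.mem_setOf_eq, hxL, iff_true] at hr
        -- `⟨x, r↾a⟩ ∉ Lmid`: every block misses
        intro i hi
        by_contra hgood
        apply hr
        refine ⟨by rw [fstF_boolPair]; exact hx.2, i, hi, ?_⟩
        rw [hg_apply, ← hl]
        have htake : ((r.take a).drop (i * l)).take l = (r.drop (i * l)).take l := by
          rw [List.drop_take, List.take_take, min_eq_left]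
          rw [hal]
          refine Nat.le_sub_of_add_le ?_
          have h8 := Nat.mul_le_mul_right l (show i + 1 ≤ 8 by omega)
          rw [Nat.succ_mul] at h8
          linarith
        rw [htake]
        by_contra hmiss
        exact hgood hmiss
      calc uniformProb (a + b) Out
          ≤ uniformProb (a + b) {r : List Bool | ∀ i < 8, (r.drop (i * l)).take l ∈ Bad} :=
            BPExp.uniformProb_mono_len hsub
        _ ≤ (3 / 4 : ℝ) ^ 8 := by
            rw [hal]
            exact bpprur_uniformProb_forall_blocks_le Bad (by norm_num) hBadP 8 b
    · -- NO-instances (and short inputs): no seed string is accepted, the verdict is always right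
      have hzero : uniformProb (a + b) Out = 0 := by
        refine BPExp.uniformProb_eq_zero_of_forall fun r _ hr => ?_
        simp only [hOut, Set.mem_setOf_eq, hx, iff_false, not_not] at hr
        obtain ⟨hn, i, hi, hmem⟩ := hr
        rw [fstF_boolPair] at hn
        have hxL : x ∉ L₁ := fun h => hx ⟨h, hn⟩
        rw [hg_apply] at hmem
        exact hNO x hxL _ hmem
      rw [hzero]
      positivity
  -- the error event is contained in `Out ∪ In`
  have hsub : ∀ r ∈ {y : List Bool | ¬ (boolPair x y ∈ (gre ⁻¹' K' : Language Bool) ↔ x ∈ L₁')},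
      r.length = a + b → r ∈ Out ∪ In := by
    intro r hbad hr
    by_contra hgood
    simp only [Set.mem_union, not_or, hOut, hIn, Set.mem_setOf_eq, not_not] at hgood
    obtain ⟨h1, h2⟩ := hgood
    have hdrop : (r.drop a).take b = r.drop a :=
      List.take_of_length_le (by rw [List.length_drop, hr]; omega)
    rw [hdrop] at h2
    apply hbad
    show gre (boolPair x r) ∈ K' ↔ x ∈ L₁'
    rw [hgre_apply, ← ha, h2, h1]
  rw [hlen]
  calc uniformProb (a + b) {y : List Bool | ¬ (boolPair x y ∈ (gre ⁻¹' K' : Language Bool) ↔ x ∈ L₁')}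
      ≤ uniformProb (a + b) (Out ∪ In) := BPExp.uniformProb_mono_len hsub
    _ ≤ uniformProb (a + b) Out + uniformProb (a + b) In := uniformProb_union_le _ _ _
    _ ≤ (3 / 4 : ℝ) ^ 8 + 1 / 5 := add_le_add hOutP hInP

end Summit.QuantumAdvantage.QuantumAdvantage.Theorems.IqThreeNotPPoly

end
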